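import Mathlib.Algebra.BigOperators.Intervals
import Mathlib.Algebra.BigOperators.NatAntidiagonal
import Mathlib.Algebra.BigOperators.Ring.Finset
import Mathlib.Tactic.LinearCombination
import Mathlib.Tactic.Ring
import Mathlib.Tactic.Push
import HarnessLib

/-!
# The q-Pfaff–Saalschütz summation (polynomial form) and the q-shifted factorial

G. Gasper, M. Rahman, *Basic Hypergeometric Series*, 2nd ed. (2004), §1.7, eq. (1.7.2)
(the *q-Saalschütz* or *q-Pfaff–Saalschütz* formula, Jackson 1910):

> `₃φ₂(a, b, q^{-n}; c, abq^{1-n}/c; q, q) = (c/a, c/b; q)_n / (c, c/(ab); q)_n`,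

where `(x; q)_m = (1-x)(1-xq)⋯(1-xq^{m-1})` is the *q-shifted factorial* (G-R (1.2.15)). Writing
`x = c/(ab)` and clearing denominators with
`(q^{-n};q)_k/(abq^{1-n}/c;q)_k = x^k q^{-k} (q;q)_n (x;q)_{n-k} / ((q;q)_{n-k} (x;q)_n)` and
`(c;q)_n/(c;q)_k = (cq^k;q)_{n-k}`, (1.7.2) is equivalent to the DENOMINATOR-FREE identity

  `∑_{k=0}^{n} [n choose k]_q (a;q)_k (b;q)_k (abx q^k;q)_{n-k} (x;q)_{n-k} x^k = (ax;q)_n (bx;q)_n` (qPS)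

(`[n choose k]_q` the Gaussian binomial), valid for `a, b, x, q` in an ARBITRARY commutative ring;
this is the form proved here (`qPfaffSaalschutz`, `qPfaffSaalschutz_antidiagonal`), the `q`-analogue of
the tree's `Literature.Combinatorics.Enumerative.pfaffSaalschutz` (the case `q → 1`). The proof is not
the book's (coefficients in Heine's transformation) but, exactly as in `PfaffSaalschutz.lean`, a
Wilf–Zeilberger style creative telescoping over the antidiagonal `k + m = n`
(Petkovšek–Wilf–Zeilberger, *A = B*, Ch. 6–7): with
`σ(k,m) = [k+m;k]_q (a;q)_k (b;q)_k (abxq^k;q)_m (x;q)_m x^k` and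
`τ(k,m) = [k+m;k]_q (a;q)_{k+1} (b;q)_{k+1} (abxq^k;q)_m (x;q)_m x^{k+1} q^m` one has, for
`k + m + 1 = n`, `σ(k+1,m+1) - (1-axq^n)(1-bxq^n) σ(k+1,m) = τ(k,m+1) - τ(k+1,m)` (the certificate;
it reduces to `(1-q^{m+1}) [n;k]_q = (1-q^{k+1}) [n;k+1]_q`, so no division is needed), and summing
over the antidiagonal telescopes to `S(n+1) = (1-axq^n)(1-bxq^n) S(n)`.

First use: Sears' `₄φ₃` transformation (sibling file) and, through it, the q-Racah three-term
recurrence behind the orthogonality of the Kauffman–Lins `q-6j` symbols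
(`RepresentationTheory/ModularTensorCategories/KLRecoupling.lean`). No named fact is introduced.

## Contents

* `qPochhammer a q n = (a;q)_n = ∏_{i<n} (1 - a q^i)` with `_succ`, `_succ_left`, `_add`;
* `qBinomial q L k = [L choose k]_q` by the `q`-Pascal rule, the second `q`-Pascal rule
  `qBinomial_succ_succ'` and `qBinomial_key`;
* `qPfaffSaalschutz_antidiagonal`, `qPfaffSaalschutz` — (qPS).

## References

* G. Gasper, M. Rahman, *Basic Hypergeometric Series* (2004), (1.2.15), §1.7 (1.7.2).
  [GasperRahman2004]
* G. E. Andrews, *The Theory of Partitions* (1976), §3.3 (3.3.3)–(3.3.4) (Gaussian binomials).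
  [Andrews1976Partitions]

## Mathlib / tree search

`lean search 'qPochhammer|Saalsch|qBinomial'`: Mathlib has neither the `q`-shifted factorial nor the
Gaussian binomial; the tree has the `q = 1` case (`PfaffSaalschutz.lean`) and a special-purpose
`qBinomial`/`qPoch q k = (q;q)_k` inside `NumberTheory/EllipticCurves/TunnellThetaCoefficientsProofs`
(namespace `Tunnell1983`, an 840-line power-series file about theta coefficients). That file is
deliberately NOT imported: pulling `PowerSeries`/theta machinery into this elementary file would be the
wrong dependency direction, and `(a;q)_n` with a general `a` (absent there) is what is needed here; so
the 3-line recursive `qBinomial` and its four one-line recursion lemmas are restated in this namespace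
(a later dedup can re-point `Tunnell1983` to the present file).
-/

namespace Literature.Combinatorics.Enumerative

open Finset

variable {R : Type*} [CommRing R]

/-! ### The q-shifted factorial -/

/-- The `q`-shifted factorial `(a; q)_n = ∏_{i<n} (1 - a q^i)` (so `(a;q)_0 = 1`).
[cite: GasperRahman2004, (1.2.15)] -/
def qPochhammer (a q : R) (n : ℕ) : R := ∏ i ∈ range n, (1 - a * q ^ i)

/-- `(a;q)_0 = 1`. [cite: GasperRahman2004, (1.2.15)] -/
@[simp] theorem qPochhammer_zero (a q : R) : qPochhammer a q 0 = 1 := by simp [qPochhammer]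

/-- `(a;q)_{n+1} = (a;q)_n (1 - a q^n)`. [cite: GasperRahman2004, (1.2.15)] -/
theorem qPochhammer_succ (a q : R) (n : ℕ) :
    qPochhammer a q (n + 1) = qPochhammer a q n * (1 - a * q ^ n) := prod_range_succ _ _

/-- `(a;q)_1 = 1 - a`. [cite: GasperRahman2004, (1.2.15)] -/
@[simp] theorem qPochhammer_one (a q : R) : qPochhammer a q 1 = 1 - a := by
  simp [qPochhammer]

/-- `(a;q)_{n+1} = (1 - a) (aq;q)_n`. [cite: GasperRahman2004, (1.2.15) and (I.18)] -/
theorem qPochhammer_succ_left (a q : R) (n : ℕ) :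
    qPochhammer a q (n + 1) = (1 - a) * qPochhammer (a * q) q n := by
  unfold qPochhammer
  rw [prod_range_succ']
  simp only [pow_zero, mul_one, pow_succ]
  rw [mul_comm]
  congr 1
  exact prod_congr rfl fun i _ => by ring

/-- `(a;q)_{m+n} = (a;q)_m (aq^m;q)_n`. [cite: GasperRahman2004, (I.17)] -/
theorem qPochhammer_add (a q : R) (m n : ℕ) :
    qPochhammer a q (m + n) = qPochhammer a q m * qPochhammer (a * q ^ m) q n := by
  unfold qPochhammer
  rw [prod_range_add]
  congr 1
  exact prod_congr rfl fun i _ => by ring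

/-! ### The Gaussian binomial -/

/-- The Gaussian (`q`-)binomial coefficient `[L choose k]_q`, an element of `R` for `q ∈ R`, defined by
the `q`-Pascal rule `[L+1, k+1]_q = q^{k+1} [L, k+1]_q + [L, k]_q`, `[L, 0]_q = 1`, `[0, k+1]_q = 0`.
[cite: Andrews1976Partitions, §3.3 Def. 3.1 and (3.3.4)] -/
def qBinomial (q : R) : ℕ → ℕ → R
  | _, 0 => 1
  | 0, _ + 1 => 0
  | L + 1, k + 1 => q ^ (k + 1) * qBinomial q L (k + 1) + qBinomial q L k

/-- `[L choose 0]_q = 1`. [cite: Andrews1976Partitions, §3.3 Def. 3.1] -/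
@[simp] theorem qBinomial_zero_right (q : R) (L : ℕ) : qBinomial q L 0 = 1 := by
  cases L <;> rfl

/-- `[0 choose k+1]_q = 0`. [cite: Andrews1976Partitions, §3.3 Def. 3.1] -/
@[simp] theorem qBinomial_zero_succ (q : R) (k : ℕ) : qBinomial q 0 (k + 1) = 0 := rfl

/-- The `q`-Pascal rule `[L+1, k+1]_q = q^(k+1) [L, k+1]_q + [L, k]_q`.
[cite: Andrews1976Partitions, §3.3 (3.3.4)] -/
theorem qBinomial_succ_succ (q : R) (L k : ℕ) :
    qBinomial q (L + 1) (k + 1) = q ^ (k + 1) * qBinomial q L (k + 1) + qBinomial q L k := rfl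

/-- `[L choose k]_q = 0` for `k > L`. [cite: Andrews1976Partitions, §3.3 Def. 3.1] -/
theorem qBinomial_eq_zero_of_lt (q : R) {L k : ℕ} (h : L < k) : qBinomial q L k = 0 := by
  induction L generalizing k with
  | zero =>
    obtain ⟨k, rfl⟩ := Nat.exists_eq_add_of_lt h
    simp
  | succ L ih =>
    obtain ⟨j, rfl⟩ := Nat.exists_eq_add_of_lt h
    rw [show L + 1 + j + 1 = (L + j + 1) + 1 by ring, qBinomial_succ_succ, ih (by omega),
      ih (by omega)]
    ring

/-- `[L choose L]_q = 1`. [cite: Andrews1976Partitions, §3.3 Def. 3.1] -/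
@[simp] theorem qBinomial_self (q : R) (L : ℕ) : qBinomial q L L = 1 := by
  induction L with
  | zero => rfl
  | succ L ih => rw [qBinomial_succ_succ, ih, qBinomial_eq_zero_of_lt q (Nat.lt_add_one L)]; ring

/-- The second `q`-Pascal rule `[L+1, k+1]_q = [L, k+1]_q + q^(L-k) [L, k]_q`, here in the
subtraction-free form `[k+m+1, k+1]_q = [k+m, k+1]_q + q^m [k+m, k]_q`.
[cite: Andrews1976Partitions, §3.3 (3.3.3)] -/
theorem qBinomial_succ_succ' (q : R) (k m : ℕ) :
    qBinomial q (k + m + 1) (k + 1) = qBinomial q (k + m) (k + 1) + q ^ m * qBinomial q (k + m) k := by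
  -- by induction on `k + m`, through the first Pascal rule
  suffices h : ∀ L k m : ℕ, k + m = L →
      qBinomial q (k + m + 1) (k + 1) = qBinomial q (k + m) (k + 1) + q ^ m * qBinomial q (k + m) k from
    h _ _ _ rfl
  intro L
  induction L with
  | zero =>
    intro k m hkm
    obtain ⟨rfl, rfl⟩ : k = 0 ∧ m = 0 := by omega
    simp
  | succ L ih =>
    intro k m hkm
    cases m with
    | zero =>
      rw [add_zero, qBinomial_eq_zero_of_lt q (Nat.lt_add_one k), qBinomial_self, qBinomial_self]
      ring
    | succ m =>
      cases k with
      | zero =>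
        -- `[m+2, 1] = [m+1, 1] + q^(m+1)`
        have e1 := qBinomial_succ_succ q (m + 1) 0
        have e2 := qBinomial_succ_succ q m 0
        have e3 := ih 0 m (by omega)
        simp only [zero_add, qBinomial_zero_right, pow_one, mul_one] at e1 e2 e3 ⊢
        linear_combination e1 + q * e3 - e2
      | succ k =>
        -- level `k + m + 3` in terms of level `k + m + 1`
        have e1 := qBinomial_succ_succ q (k + m + 2) (k + 1)
        have e4 := qBinomial_succ_succ q (k + m + 1) (k + 1)
        have e5 := qBinomial_succ_succ q (k + m + 1) k
        have e2 := ih (k + 1) m (by omega)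
        have e3 := ih k (m + 1) (by omega)
        rw [show k + 1 + m = k + m + 1 by ring] at e2
        rw [show k + (m + 1) = k + m + 1 by ring] at e3
        rw [show k + 1 + (m + 1) + 1 = k + m + 2 + 1 by ring, show k + 1 + (m + 1) = k + m + 1 + 1 by ring]
        linear_combination e1 + q ^ (k + 1 + 1) * e2 - e4 + e3 - q ^ (m + 1) * e5

/-- The key relation between neighbouring Gaussian binomials used by the creative telescoping:
`(1 - q^{m+1}) [k+m+1, k]_q = (1 - q^{k+1}) [k+m+1, k+1]_q` (difference of the two `q`-Pascal rules).
[cite: Andrews1976Partitions, §3.3 (3.3.3)–(3.3.4)] -/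
theorem qBinomial_key (q : R) (k m : ℕ) :
    (1 - q ^ (m + 1)) * qBinomial q (k + m + 1) k = (1 - q ^ (k + 1)) * qBinomial q (k + m + 1) (k + 1) := by
  -- `[k+m+2, k+1]` expanded by both Pascal rules
  have h1 := qBinomial_succ_succ q (k + m + 1) k
  have h2 := qBinomial_succ_succ' q k (m + 1)
  rw [show k + (m + 1) + 1 = k + m + 1 + 1 by ring, show k + (m + 1) = k + m + 1 by ring] at h2
  linear_combination h2 - h1

/-! ### The q-Pfaff–Saalschütz summation -/

/-- **The q-Pfaff–Saalschütz summation, polynomial form, summed over the antidiagonal**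
(Gasper–Rahman (1.7.2) with `x = c/(ab)`, cleared of denominators; module docstring): for
`a, b, x, q` in a commutative ring and `n ∈ ℕ`,
`∑_{k+m=n} [k+m;k]_q (a;q)_k (b;q)_k (abxq^k;q)_m (x;q)_m x^k = (ax;q)_n (bx;q)_n`.
Proof by creative telescoping (module docstring). [cite: GasperRahman2004, §1.7 eq. (1.7.2)] -/
theorem qPfaffSaalschutz_antidiagonal (a b x q : R) (n : ℕ) :
    ∑ ij ∈ antidiagonal n, qBinomial q (ij.1 + ij.2) ij.1 * qPochhammer a q ij.1 *
        qPochhammer b q ij.1 * qPochhammer (a * b * x * q ^ ij.1) q ij.2 * qPochhammer x q ij.2 *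
        x ^ ij.1 =
      qPochhammer (a * x) q n * qPochhammer (b * x) q n := by
  -- the summand and the certificate, indexed by the antidiagonal `k + m = n`
  set σ : ℕ → ℕ → R := fun k m => qBinomial q (k + m) k * qPochhammer a q k * qPochhammer b q k *
    qPochhammer (a * b * x * q ^ k) q m * qPochhammer x q m * x ^ k with hσ
  set τ : ℕ → ℕ → R := fun k m => qBinomial q (k + m) k * qPochhammer a q (k + 1) *
    qPochhammer b q (k + 1) * qPochhammer (a * b * x * q ^ k) q m * qPochhammer x q m *
    x ^ (k + 1) * q ^ m with hτ
  -- the creative-telescoping identity (interior terms)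
  have hT : ∀ k m : ℕ, σ (k + 1) (m + 1) -
      (1 - a * x * q ^ (k + m + 1)) * (1 - b * x * q ^ (k + m + 1)) * σ (k + 1) m =
      τ k (m + 1) - τ (k + 1) m := by
    intro k m
    simp only [hσ, hτ]
    -- peel the q-shifted factorials down to the common core
    rw [qPochhammer_succ (a * b * x * q ^ (k + 1)) q m, qPochhammer_succ x q m,
      qPochhammer_succ_left (a * b * x * q ^ k) q m, qPochhammer_succ a q (k + 1),
      qPochhammer_succ b q (k + 1)]
    have hshift : qPochhammer (a * b * x * q ^ k * q) q m = qPochhammer (a * b * x * q ^ (k + 1)) q m := by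
      rw [pow_succ, mul_assoc]
    rw [hshift]
    -- the Gaussian binomials
    rw [show k + 1 + (m + 1) = (k + m + 1) + 1 by ring, qBinomial_succ_succ,
      show k + 1 + m = k + m + 1 by ring, show k + (m + 1) = k + m + 1 by ring]
    have hkey := qBinomial_key q k m
    linear_combination (qPochhammer a q (k + 1) * qPochhammer b q (k + 1) *
      qPochhammer (a * b * x * q ^ (k + 1)) q m * qPochhammer x q m * x ^ (k + 1) *
      (1 - x * q ^ m)) * hkey
  -- boundary identities
  have hB0 : ∀ n : ℕ, σ 0 (n + 1) - (1 - a * x * q ^ n) * (1 - b * x * q ^ n) * σ 0 n = -τ 0 n := by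
    intro n
    simp only [hσ, hτ]
    rw [qPochhammer_succ (a * b * x * q ^ 0) q n, qPochhammer_succ x q n]
    simp
    ring
  have hB1 : ∀ n : ℕ, σ (n + 1) 0 = τ n 0 := by
    intro n
    simp [hσ, hτ]
  -- the antidiagonal sums
  have hmain : ∀ n : ℕ, ∑ ij ∈ antidiagonal n, σ ij.1 ij.2 =
      qPochhammer (a * x) q n * qPochhammer (b * x) q n := by
    intro n
    induction n with
    | zero => simp [hσ]
    | succ n ih =>
      rw [qPochhammer_succ (a * x) q n, qPochhammer_succ (b * x) q n, mul_mul_mul_comm, ← ih]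
      cases n with
      | zero =>
        rw [Nat.sum_antidiagonal_succ]
        simp [hσ]
        ring
      | succ n =>
        -- peel both ends of the antidiagonal of `n + 2`, and one end of that of `n + 1`
        rw [Nat.sum_antidiagonal_succ]
        rw [Nat.sum_antidiagonal_succ' (f := fun ij : ℕ × ℕ => σ (ij.1 + 1) ij.2)]
        conv_rhs => rw [Nat.sum_antidiagonal_succ]
        -- apply the telescoping identity inside the sum
        have hsum : ∑ ij ∈ antidiagonal n, σ (ij.1 + 1) (ij.2 + 1) =
            ∑ ij ∈ antidiagonal n, ((1 - a * x * q ^ (n + 1)) * (1 - b * x * q ^ (n + 1)) *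
              σ (ij.1 + 1) ij.2 + (τ ij.1 (ij.2 + 1) - τ (ij.1 + 1) ij.2)) := by
          refine sum_congr rfl fun ij hij => ?_
          have hkm : ij.1 + ij.2 = n := mem_antidiagonal.mp hij
          have h := hT ij.1 ij.2
          rw [show ij.1 + ij.2 + 1 = n + 1 by omega] at h
          linear_combination h
        have htel : ∑ ij ∈ antidiagonal n, (τ ij.1 (ij.2 + 1) - τ (ij.1 + 1) ij.2) =
            τ 0 (n + 1) - τ (n + 1) 0 := by
          rw [sum_sub_distrib]
          have h1 := Nat.sum_antidiagonal_succ' (f := fun ij : ℕ × ℕ => τ ij.1 ij.2) (n := n)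
          have h2 := Nat.sum_antidiagonal_succ (f := fun ij : ℕ × ℕ => τ ij.1 ij.2) (n := n)
          simp only at h1 h2
          linear_combination h2 - h1
        rw [hsum, sum_add_distrib, htel, ← mul_sum]
        have h0 := hB0 (n + 1)
        have h1 := hB1 (n + 1)
        simp only at h0 h1 ⊢
        linear_combination h0 + h1
  exact hmain n

/-- **The q-Pfaff–Saalschütz summation, polynomial form** (Gasper–Rahman (1.7.2) with `x = c/(ab)`,
cleared of denominators): for `a, b, x, q` in a commutative ring and `n ∈ ℕ`,
`∑_{k=0}^{n} [n;k]_q (a;q)_k (b;q)_k (abxq^k;q)_{n-k} (x;q)_{n-k} x^k = (ax;q)_n (bx;q)_n`.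
[cite: GasperRahman2004, §1.7 eq. (1.7.2)] -/
theorem qPfaffSaalschutz (a b x q : R) (n : ℕ) :
    ∑ k ∈ range (n + 1), qBinomial q n k * qPochhammer a q k * qPochhammer b q k *
        qPochhammer (a * b * x * q ^ k) q (n - k) * qPochhammer x q (n - k) * x ^ k =
      qPochhammer (a * x) q n * qPochhammer (b * x) q n := by
  rw [← qPfaffSaalschutz_antidiagonal a b x q n, Nat.sum_antidiagonal_eq_sum_range_succ
    (fun k m => qBinomial q (k + m) k * qPochhammer a q k * qPochhammer b q k *
      qPochhammer (a * b * x * q ^ k) q m * qPochhammer x q m * x ^ k)]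
  refine sum_congr rfl fun k hk => ?_
  have hkn : k + (n - k) = n := by
    have := mem_range.mp hk
    omega
  simp only [hkn]

end Literature.Combinatorics.Enumerative
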